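import Mathlib
import Literature.NumberTheory.GaloisRepresentations.LAdicCharacterUnramifiedAEProofs

/-!
# IwahoriTransientSplit — CERTIFICATE (landing part 1/2) — lens-3 gen 25, cell `decomp-langlands`

Cyclotomic rigidity and inertial eigenvalue rigidity in `ℚ̄_ℓ = PadicAlgCl ℓ` (§8) and the BC5 model witness (§8b) of the node
HOME/nodes/lens-3-g25-IwahoriTransientSplit.lean (U = `AuxiliaryLevelSplit.LevelFiniteness` 27042 ⟺ SemistableShaping ∧ IwahoriLevelConfinement;
the split itself = `Theorems/IwahoriTransientSplitLevelFiniteness…` part 2/2).  Mathlib + the tree module `LAdicCharacterUnramifiedAEProofs` (`PadicAlgCl.norm_natCast_self`, and cf. its `PadicAlgCl.eq_one_of_pow_eq_one_of_norm_sub_one_lt` = rigidity at the radius |ℓ|; §8 here gives the SHARP cyclotomic radius |ℓ|^(n/(ℓ-1)) and the coefficientwise form the items need); 0 sorry; axioms propext / Classical.choice / Quot.sound.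
Main statements: `norm_natCast_le_norm_sub_one_pow` (‖ℓ‖ ≤ ‖ζ−1‖^(ℓ−1) for a root of unity ζ ≠ 1), `eq_one_of_coeff_lt` / `eq_one_of_valued_lt`
(a root of unity whose polynomial is coefficientwise within |ℓ|^n of (X−1)^n equals 1 — SSH's place-independent shaping radius), `toyShaping_holds` /
`toyLevelBound_fails` / `toy_separates` (in the local-inertial model SSH's analogue is a theorem and U's analogue is false).
-/

set_option linter.dupNamespace false
set_option linter.unusedVariables false

namespace Summit.Langlands.Langlands.Theorems.IwahoriTransient

open scoped Polynomial

/-! ## 8. THE CERTIFICATE of the translation (lens-3's checkable dictionary): cyclotomic rigidity and inertial eigenvalue rigidity in `ℚ̄_ℓ`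
(`PadicAlgCl ℓ`, Mathlib's normed algebraic closure of `ℚ_ℓ`; `Valued.v = ‖·‖₊`).  These are the lemmas that make SSH's shaping radius
PLACE-INDEPENDENT: below the radius |ℓ|^n an inertial eigenvalue congruent to 1 IS 1.  Fully proved. -/

section Certificate

variable {ℓ : ℕ} [Fact ℓ.Prime]

/-- the items' `Valued.v x < r` is `‖x‖ < r`. -/
theorem valued_lt_iff (x : PadicAlgCl ℓ) (r : NNReal) : Valued.v x < r ↔ ‖x‖ < (r : ℝ) := by
  rw [PadicAlgCl.valuation_def, ← NNReal.coe_lt_coe, coe_nnnorm]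

/-- natural numbers are ℓ-adic integers: `‖(m : ℚ̄_ℓ)‖ ≤ 1`. -/
theorem norm_natCast_le_one (m : ℕ) : ‖(m : PadicAlgCl ℓ)‖ ≤ 1 := by
  have h : ((m : ℚ_[ℓ]) : PadicAlgCl ℓ) = (m : PadicAlgCl ℓ) := map_natCast (algebraMap ℚ_[ℓ] (PadicAlgCl ℓ)) m
  rw [← h, PadicAlgCl.norm_extends]
  simpa using Padic.norm_int_le_one (p := ℓ) (m : ℤ)

/-- a natural number prime to ℓ is an ℓ-adic unit: `‖(m : ℚ̄_ℓ)‖ = 1`. -/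
theorem norm_natCast_eq_one {m : ℕ} (hm : ℓ.Coprime m) : ‖(m : PadicAlgCl ℓ)‖ = 1 := by
  have h : ((m : ℚ_[ℓ]) : PadicAlgCl ℓ) = (m : PadicAlgCl ℓ) := map_natCast (algebraMap ℚ_[ℓ] (PadicAlgCl ℓ)) m
  rw [← h, PadicAlgCl.norm_extends]
  exact Padic.norm_natCast_eq_one_iff.mpr hm

/-- a root of unity has norm 1. -/
theorem norm_eq_one_of_pow_eq_one {ζ : PadicAlgCl ℓ} {k : ℕ} (hk : k ≠ 0) (hζ : ζ ^ k = 1) : ‖ζ‖ = 1 := by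
  have h : ‖ζ‖ ^ k = 1 := by rw [← norm_pow, hζ, norm_one]
  exact (pow_eq_one_iff_of_nonneg (norm_nonneg ζ) hk).mp h

/-- ultrametric bound for a geometric sum of an integral element. -/
theorem norm_geom_sum_le_one {ζ : PadicAlgCl ℓ} (hζ : ‖ζ‖ ≤ 1) (j : ℕ) : ‖∑ i ∈ Finset.range j, ζ ^ i‖ ≤ 1 := by
  refine IsUltrametricDist.norm_sum_le_of_forall_le_of_nonneg zero_le_one fun i _ => ?_
  rw [norm_pow]
  exact pow_le_one₀ (norm_nonneg _) hζ

/-- `‖1 − ζ^j‖ ≤ ‖1 − ζ‖` for integral `ζ` (the factor `1 + ζ + ⋯ + ζ^{j−1}` is integral). -/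
theorem norm_one_sub_pow_le {ζ : PadicAlgCl ℓ} (hζ : ‖ζ‖ ≤ 1) (j : ℕ) : ‖1 - ζ ^ j‖ ≤ ‖1 - ζ‖ := by
  rw [← mul_neg_geom_sum ζ j, norm_mul]
  calc ‖1 - ζ‖ * ‖∑ i ∈ Finset.range j, ζ ^ i‖ ≤ ‖1 - ζ‖ * 1 :=
        mul_le_mul_of_nonneg_left (norm_geom_sum_le_one hζ j) (norm_nonneg _)
    _ = ‖1 - ζ‖ := mul_one _

/-- `‖1 − ζ‖ ≤ 1` for integral `ζ`. -/
theorem norm_one_sub_le_one {ζ : PadicAlgCl ℓ} (hζ : ‖ζ‖ ≤ 1) : ‖1 - ζ‖ ≤ 1 := by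
  calc ‖(1 : PadicAlgCl ℓ) - ζ‖ = ‖(1 : PadicAlgCl ℓ) + (-ζ)‖ := by rw [sub_eq_add_neg]
    _ ≤ max ‖(1 : PadicAlgCl ℓ)‖ ‖-ζ‖ := IsUltrametricDist.norm_add_le_max _ _
    _ ≤ 1 := max_le (by simp) (by rwa [norm_neg])

/-- for a PRIMITIVE `p`-th root of unity `μ` (p prime): `‖(p : ℚ̄_ℓ)‖ ≤ ‖1 − μ‖^{p−1}` — from `p = Φ_p(1) = ∏ (1 − μ')` over the primitive
`p`-th roots `μ' = μ^i`, each factor bounded by `‖1 − μ‖`. -/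
theorem norm_prime_le_of_isPrimitiveRoot {p : ℕ} [hp : Fact p.Prime] {μ : PadicAlgCl ℓ} (hμ : IsPrimitiveRoot μ p) :
    ‖(p : PadicAlgCl ℓ)‖ ≤ ‖1 - μ‖ ^ (p - 1) := by
  have hμ1 : ‖μ‖ ≤ 1 := (norm_eq_one_of_pow_eq_one hp.out.ne_zero hμ.pow_eq_one).le
  have hprod : (p : PadicAlgCl ℓ) = ∏ μ' ∈ primitiveRoots p (PadicAlgCl ℓ), (1 - μ') := by
    have h1 := Polynomial.eval_one_cyclotomic_prime (R := PadicAlgCl ℓ) (p := p)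
    rw [Polynomial.cyclotomic_eq_prod_X_sub_primitiveRoots hμ, Polynomial.eval_prod] at h1
    simpa using h1.symm
  have hcard : (primitiveRoots p (PadicAlgCl ℓ)).card = p - 1 := by
    rw [hμ.card_primitiveRoots, Nat.totient_prime hp.out]
  rw [hprod, norm_prod, ← hcard, ← Finset.prod_const]
  refine Finset.prod_le_prod (fun _ _ => norm_nonneg _) fun μ' hμ' => ?_
  haveI : NeZero p := ⟨hp.out.ne_zero⟩
  obtain ⟨i, -, rfl⟩ := hμ.eq_pow_of_pow_eq_one ((mem_primitiveRoots hp.out.pos).mp hμ').pow_eq_one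
  exact norm_one_sub_pow_le hμ1 i

/-- CYCLOTOMIC RIGIDITY (the certificate, part 1): a root of unity `ζ ≠ 1` in `ℚ̄_ℓ` satisfies `‖ζ − 1‖^{ℓ−1} ≥ ‖ℓ‖ = ℓ⁻¹`
(for `ζ` of ℓ-power order this is the classical `v_ℓ(ζ − 1) ≤ 1/(ℓ−1)`; for other orders `ζ − 1` is a unit). -/
theorem norm_natCast_le_norm_sub_one_pow {ζ : PadicAlgCl ℓ} {k : ℕ} (hk : k ≠ 0) (hζ : ζ ^ k = 1) (h1 : ζ ≠ 1) :
    ‖(ℓ : PadicAlgCl ℓ)‖ ≤ ‖ζ - 1‖ ^ (ℓ - 1) := by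
  have hℓ : ℓ.Prime := Fact.out
  have hnζ : ‖ζ‖ ≤ 1 := (norm_eq_one_of_pow_eq_one hk hζ).le
  have hfin : IsOfFinOrder ζ := isOfFinOrder_iff_pow_eq_one.mpr ⟨k, Nat.pos_of_ne_zero hk, hζ⟩
  have hd0 : 0 < orderOf ζ := hfin.orderOf_pos
  have hd1 : orderOf ζ ≠ 1 := fun h => h1 (orderOf_eq_one_iff.mp h)
  -- a prime p dividing the order, and a primitive p-th root of unity μ = ζ^(d/p)
  obtain ⟨p, hpprime, hpd⟩ := Nat.exists_prime_and_dvd hd1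
  haveI hp : Fact p.Prime := ⟨hpprime⟩
  have hμ : IsPrimitiveRoot (ζ ^ (orderOf ζ / p)) p := by
    have h := orderOf_pow_orderOf_div hd0.ne' hpd
    have hprim := IsPrimitiveRoot.orderOf (ζ ^ (orderOf ζ / p))
    rwa [h] at hprim
  have hle : ‖(p : PadicAlgCl ℓ)‖ ≤ ‖1 - ζ‖ ^ (p - 1) :=
    (norm_prime_le_of_isPrimitiveRoot hμ).trans (pow_le_pow_left₀ (norm_nonneg _) (norm_one_sub_pow_le hnζ _) _)
  have h1ζ : ‖1 - ζ‖ ≤ 1 := norm_one_sub_le_one hnζ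
  rw [norm_sub_rev]
  by_cases hpl : p = ℓ
  · rw [hpl] at hle
    exact hle
  · -- p ≠ ℓ: ‖p‖ = 1 forces ‖1 - ζ‖ = 1 ≥ ‖ℓ‖
    have hcop : ℓ.Coprime p := (Nat.coprime_primes hℓ hpprime).mpr (Ne.symm hpl)
    have hp1 : ‖(p : PadicAlgCl ℓ)‖ = 1 := norm_natCast_eq_one hcop
    have hone : ‖1 - ζ‖ = 1 := by
      by_contra hne
      have hlt : ‖1 - ζ‖ < 1 := lt_of_le_of_ne h1ζ hne
      have hp2 : p - 1 ≠ 0 := by have := hpprime.two_le; omega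
      have : ‖1 - ζ‖ ^ (p - 1) < 1 := pow_lt_one₀ (norm_nonneg _) hlt hp2
      linarith
    rw [hone, one_pow]
    exact norm_natCast_le_one ℓ

/-- ultrametric evaluation bound: if every coefficient of `Q` has norm `≤ C` (`C ≥ 0`) and `‖ζ‖ ≤ 1` then `‖Q(ζ)‖ ≤ C`. -/
theorem norm_eval_le_of_coeff_le {Q : (PadicAlgCl ℓ)[X]} {ζ : PadicAlgCl ℓ} (hζ : ‖ζ‖ ≤ 1) {C : ℝ} (hC : 0 ≤ C)
    (h : ∀ i, ‖Q.coeff i‖ ≤ C) : ‖Q.eval ζ‖ ≤ C := by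
  rw [Polynomial.eval_eq_sum_range]
  refine IsUltrametricDist.norm_sum_le_of_forall_le_of_nonneg hC fun i _ => ?_
  rw [norm_mul, norm_pow]
  calc ‖Q.coeff i‖ * ‖ζ‖ ^ i ≤ C * 1 := mul_le_mul (h i) (pow_le_one₀ (norm_nonneg _) hζ) (pow_nonneg (norm_nonneg _) _) hC
    _ = C := mul_one C

/-- INERTIAL EIGENVALUE RIGIDITY (the certificate, part 2): a root of unity `ζ` that is a root of a polynomial `P` whose coefficients
are within `ε` of those of `(X − 1)^n`, with `ε^{ℓ−1} ≤ ‖ℓ‖^n`, equals `1`.  (Read: the characteristic polynomial of an approximant's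
avatar at an inertia element, congruent to `(X − 1)^n` = that of the unramified target, has only the eigenvalue 1 — unipotent inertia.) -/
theorem eq_one_of_coeff_close {ζ : PadicAlgCl ℓ} {k : ℕ} (hk : k ≠ 0) (hζ : ζ ^ k = 1) {n : ℕ}
    {P : (PadicAlgCl ℓ)[X]} (hP : P.IsRoot ζ) {ε : ℝ} (hε : ε ^ (ℓ - 1) ≤ ‖(ℓ : PadicAlgCl ℓ)‖ ^ n)
    (hclose : ∀ i, ‖(P - (Polynomial.X - Polynomial.C 1) ^ n).coeff i‖ < ε) : ζ = 1 := by
  by_contra h1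
  have hℓ : ℓ.Prime := Fact.out
  have hnζ : ‖ζ‖ ≤ 1 := (norm_eq_one_of_pow_eq_one hk hζ).le
  set Q : (PadicAlgCl ℓ)[X] := (Polynomial.X - Polynomial.C 1) ^ n - P with hQ
  have hQc : ∀ i, ‖Q.coeff i‖ < ε := fun i => by
    rw [hQ, ← neg_sub, Polynomial.coeff_neg, norm_neg]
    exact hclose i
  -- a maximal coefficient norm C0 < ε
  obtain ⟨C0, hC0, hC0lt, hQle⟩ : ∃ C0 : ℝ, 0 ≤ C0 ∧ C0 < ε ∧ ∀ i, ‖Q.coeff i‖ ≤ C0 := by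
    let s := Finset.range (Q.natDegree + 1)
    have hs : s.Nonempty := ⟨0, by simp [s]⟩
    obtain ⟨j, _hj, hmax⟩ := Finset.exists_max_image s (fun i => ‖Q.coeff i‖) hs
    refine ⟨‖Q.coeff j‖, norm_nonneg _, hQc j, fun i => ?_⟩
    by_cases hi : i ∈ s
    · exact hmax i hi
    · have hlt : Q.natDegree < i := by
        simp only [s, Finset.mem_range, not_lt] at hi
        omega
      rw [Polynomial.coeff_eq_zero_of_natDegree_lt hlt, norm_zero]
      exact norm_nonneg _
  have heval : (ζ - 1) ^ n = Q.eval ζ := by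
    have hP0 : P.eval ζ = 0 := hP
    simp [hQ, hP0]
  have hlt : ‖ζ - 1‖ ^ n < ε := by
    rw [← norm_pow, heval]
    exact (norm_eval_le_of_coeff_le hnζ hC0 hQle).trans_lt hC0lt
  have hcr := norm_natCast_le_norm_sub_one_pow hk hζ h1
  have hℓ1 : ℓ - 1 ≠ 0 := by have := hℓ.two_le; omega
  have habs : ‖(ℓ : PadicAlgCl ℓ)‖ ^ n < ‖(ℓ : PadicAlgCl ℓ)‖ ^ n :=
    calc ‖(ℓ : PadicAlgCl ℓ)‖ ^ n ≤ (‖ζ - 1‖ ^ (ℓ - 1)) ^ n := pow_le_pow_left₀ (norm_nonneg _) hcr n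
      _ = (‖ζ - 1‖ ^ n) ^ (ℓ - 1) := by rw [← pow_mul, ← pow_mul, mul_comm]
      _ < ε ^ (ℓ - 1) := pow_lt_pow_left₀ hlt (pow_nonneg (norm_nonneg _) _) hℓ1
      _ ≤ ‖(ℓ : PadicAlgCl ℓ)‖ ^ n := hε
  exact lt_irrefl _ habs

/-- THE UNIFORM SHAPING RADIUS: coefficientwise closeness `< ‖ℓ‖^n = ℓ^{−n}` to `(X − 1)^n` already forces `ζ = 1` — a bound depending on
`n` and `ℓ` only, NOT on the place: this is what makes SSH's exceptional set `S₀` independent of the depth. -/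
theorem eq_one_of_coeff_lt {ζ : PadicAlgCl ℓ} {k : ℕ} (hk : k ≠ 0) (hζ : ζ ^ k = 1) {n : ℕ}
    {P : (PadicAlgCl ℓ)[X]} (hP : P.IsRoot ζ)
    (hclose : ∀ i, ‖(P - (Polynomial.X - Polynomial.C 1) ^ n).coeff i‖ < ‖(ℓ : PadicAlgCl ℓ)‖ ^ n) : ζ = 1 := by
  have hℓ : ℓ.Prime := Fact.out
  have hℓ1 : ℓ - 1 ≠ 0 := by have := hℓ.two_le; omega
  refine eq_one_of_coeff_close hk hζ hP ?_ hclose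
  exact pow_le_of_le_one (pow_nonneg (norm_nonneg _) _) (pow_le_one₀ (norm_nonneg _) (norm_natCast_le_one ℓ)) hℓ1

/-- the same radius in the items' `Valued.v` currency: `Valued.v x < (ℓ⁻¹)^n`. -/
theorem eq_one_of_valued_lt {ζ : PadicAlgCl ℓ} {k : ℕ} (hk : k ≠ 0) (hζ : ζ ^ k = 1) {n : ℕ}
    {P : (PadicAlgCl ℓ)[X]} (hP : P.IsRoot ζ)
    (hclose : ∀ i, Valued.v ((P - (Polynomial.X - Polynomial.C 1) ^ n).coeff i) < ((ℓ : NNReal)⁻¹) ^ n) : ζ = 1 := by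
  refine eq_one_of_coeff_lt (n := n) hk hζ hP fun i => ?_
  have h := (valued_lt_iff _ _).mp (hclose i)
  rwa [NNReal.coe_pow, NNReal.coe_inv, NNReal.coe_natCast, ← Literature.NumberTheory.GaloisRepresentations.PadicAlgCl.norm_natCast_self] at h

/-! ### 8b. BC5 MODEL WITNESS — the local-inertial toy of the split (D-0033 T3).  Replace, in the items' closeness clause, the
L-normalised Satake polynomial by the TRIVIAL inertial type `(X-1)^n` and `charpoly ρ(Frob_v)` by the characteristic polynomial of a
quasi-unipotent matrix `M` (the avatar of a deep approximant on a generator of tame inertia; its eigenvalues are roots of unity —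
Grothendieck).  The toy of SSH («closeness at radius |ℓ|^n forces Iwahori SHAPE = unipotent inertia») is a THEOREM
(`toyShaping_holds`, from `eq_one_of_valued_lt`); the toy of U («closeness forces the LEVEL away = trivial inertia») is FALSE
(`toyLevelBound_fails`: the unipotent Jordan block has characteristic polynomial exactly `(X-1)^2`).  In the model SSH's analogue is
decided and U's fails: characteristic polynomials see the shape of the auxiliary level, never the monodromy — which is why the
residual ILC (level lowering at Iwahori places) is a separate statement. -/

/-- BC5 rung (MODEL of SSH — toy shaping, PROVED; no `def`, so that the certificate lands as a pure proof file): a matrix over `ℚ̄_ℓ`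
whose eigenvalues are `k`-th roots of unity and whose characteristic polynomial is coefficientwise within `|ℓ|^n` of `(X-1)^n` (the
items' `Valued.v … < r` currency) is UNIPOTENT — every eigenvalue equals `1`: inertial eigenvalue rigidity decides the SHAPE. -/
theorem toyShaping_holds (n : ℕ) (M : Matrix (Fin n) (Fin n) (PadicAlgCl ℓ))
    (hk : ∃ k : ℕ, k ≠ 0 ∧ ∀ ζ, M.charpoly.IsRoot ζ → ζ ^ k = 1)
    (hclose : ∀ i, Valued.v ((M.charpoly - (Polynomial.X - Polynomial.C 1) ^ n).coeff i) < ((ℓ : NNReal)⁻¹) ^ n) :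
    ∀ ζ, M.charpoly.IsRoot ζ → ζ = 1 := by
  intro ζ hζ
  obtain ⟨k, hk0, hroots⟩ := hk
  exact eq_one_of_valued_lt (n := n) hk0 (hroots ζ hζ) hζ hclose

/-- BC5 separation (MODEL of U — toy level bound, REFUTED): under the SAME hypotheses the matrix need not be trivial — the unipotent
Jordan block `!![1,1;0,1]` has eigenvalues `1` (first roots of unity) and characteristic polynomial exactly `(X-1)^2` (distance `0 <`
every radius), yet it is not the identity: Iwahori level is invisible to characteristic polynomials.  So in the model SSH's analogue is
a theorem and U's analogue is false; what separates them is exactly level lowering at Iwahori places (the residual ILC). -/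
theorem toyLevelBound_fails : ∃ M : Matrix (Fin 2) (Fin 2) (PadicAlgCl ℓ),
    (∃ k : ℕ, k ≠ 0 ∧ ∀ ζ, M.charpoly.IsRoot ζ → ζ ^ k = 1) ∧
    (∀ i, Valued.v ((M.charpoly - (Polynomial.X - Polynomial.C 1) ^ 2).coeff i) < ((ℓ : NNReal)⁻¹) ^ 2) ∧ M ≠ 1 := by
  have hℓ : ℓ.Prime := Fact.out
  set M : Matrix (Fin 2) (Fin 2) (PadicAlgCl ℓ) := !![1, 1; 0, 1] with hMdef
  have hchar : M.charpoly = (Polynomial.X - Polynomial.C 1) ^ 2 := by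
    have htr : M.trace = 2 := by
      rw [hMdef, Matrix.trace_fin_two_of]; norm_num
    have hdet : M.det = 1 := by
      rw [hMdef, Matrix.det_fin_two_of]; norm_num
    rw [Matrix.charpoly_fin_two, htr, hdet]
    simp only [map_one, map_ofNat]
    ring
  refine ⟨M, ⟨1, one_ne_zero, fun ζ hζ => ?_⟩, fun i => ?_, fun hM => ?_⟩
  · rw [hchar, Polynomial.IsRoot, Polynomial.eval_pow, Polynomial.eval_sub, Polynomial.eval_X, Polynomial.eval_C] at hζ
    have := pow_eq_zero_iff (n := 2) (by norm_num) |>.mp hζ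
    rw [pow_one]; exact sub_eq_zero.mp this
  · rw [hchar, sub_self, Polynomial.coeff_zero, map_zero]
    have : (0 : NNReal) < (ℓ : NNReal)⁻¹ := by
      have : (0 : NNReal) < (ℓ : NNReal) := by exact_mod_cast hℓ.pos
      exact inv_pos.mpr this
    positivity
  · have h01 := congrArg (fun N : Matrix (Fin 2) (Fin 2) (PadicAlgCl ℓ) => N 0 1) hM
    simp [hMdef] at h01

/-- the model in one line (BC5 witness of weakness for SSH): toy-SSH holds for every size `n` and toy-U fails already for `n = 2`,
under literally the same hypotheses. -/
theorem toy_separates :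
    (∀ (n : ℕ) (M : Matrix (Fin n) (Fin n) (PadicAlgCl ℓ)), (∃ k : ℕ, k ≠ 0 ∧ ∀ ζ, M.charpoly.IsRoot ζ → ζ ^ k = 1) →
      (∀ i, Valued.v ((M.charpoly - (Polynomial.X - Polynomial.C 1) ^ n).coeff i) < ((ℓ : NNReal)⁻¹) ^ n) →
        ∀ ζ, M.charpoly.IsRoot ζ → ζ = 1) ∧
    ¬ (∀ (n : ℕ) (M : Matrix (Fin n) (Fin n) (PadicAlgCl ℓ)), (∃ k : ℕ, k ≠ 0 ∧ ∀ ζ, M.charpoly.IsRoot ζ → ζ ^ k = 1) →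
      (∀ i, Valued.v ((M.charpoly - (Polynomial.X - Polynomial.C 1) ^ n).coeff i) < ((ℓ : NNReal)⁻¹) ^ n) → M = 1) := by
  refine ⟨toyShaping_holds, fun h => ?_⟩
  obtain ⟨M, hk, hclose, hne⟩ := toyLevelBound_fails (ℓ := ℓ)
  exact hne (h 2 M hk hclose)

end Certificate

#print axioms norm_natCast_le_norm_sub_one_pow
#print axioms eq_one_of_coeff_lt
#print axioms toy_separates

end Summit.Langlands.Langlands.Theorems.IwahoriTransient
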